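import Literature.Probability.Percolation.PercolationProofs
import HarnessLib

/-!
# Newman–Tassion–Wu 2017, Lemma 4.2 — the combinatorial lemma for continuous edge labels

Topic: `Literature/Probability/Percolation`. Newman, Tassion and Wu prove their main theorem (the
minimal spanning forest of a slab `ℤ² × {0, …, k}` is a single tree, Thm 2.4) by a local surgery on
the i.i.d. uniform edge labels `ω = (ω(e))_{e ∈ E}` (the coupling `labelMeasure` of the tree,
Grimmett 1999 §1.3): finitely many labels are LOWERED affinely, `ω(e) ↦ a·ω(e)` (to open the edge at
level `a = p_c`), or RAISED affinely, `ω(e) ↦ b + (1 - b)·ω(e)` (to close it at every level `< b`).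
The measure-theoretic engine is their Lemma 4.2 (an extension of the combinatorial Lemma 7 of
Duminil-Copin–Sidoravicius–Tassion to continuous labels), arXiv:1512.09107 p. 19:

> **Lemma 4.2.** Consider `𝓐, 𝓑 ⊂ 𝓕`, `a, b ∈ (0,1)`, and a measurable map `Φ : 𝓐 → 𝓑`. If for
> any `ω' ∈ Φ(𝓐)` there exists `S(ω') ⊂ E` with at most `s` edges such that
> `Φ⁻¹(ω') ⊂ {ω : ω|_{Sᶜ} = ω'|_{Sᶜ}} ∩ ⋃_{L ⊂ S} ({ω : ω|_L = a⁻¹ ω'|_L} ∩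
> {ω : ω|_{S∖L} = (ω' - b)/(1 - b)|_{S∖L}})`, then `ℙ[𝓐] ≤ (2/(a ∧ (1 - b)))^s ℙ[𝓑]`.

and the Remark following it: "An equivalent way of stating the hypotheses on `Φ` is that `Φ` leaves
all but at most `s` of the `ω(e)`'s unchanged, with the others either lowered (by `ω(e) ↦ aω(e)`),
or raised (by `ω(e) ↦ b + (1-b)ω(e)`) and the set `S` of changed edges is uniquely determined by
`ω' = Φ(ω)`." The printed proof: partition `𝓐` into `≤ 2^s` pieces on which `Φ` is injective with
Jacobian `≥ (a ∧ (1-b))^s`, change variables, sum.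

This file proves the lemma in the Remark's form, on the tree's label space
`(Sym2 V → ℝ, labelMeasure V)`:

* `NTW17.affineRelabel a b S L` — the relabelling `T_{S,L}`: coordinates in `S ∩ L` lowered,
  coordinates in `S ∖ L` raised, all others unchanged; `NTW17.affineRelabelEquiv` — the same map as a
  measurable automorphism of the label space (`a ≠ 0`, `b ≠ 1`);
* `NTW17.mul_labelMeasure_le_labelMeasure_image_affineRelabel` — **the Jacobian inequality**
  `a^{#(S ∩ L)} (1-b)^{#(S ∖ L)} · ℙ[A] ≤ ℙ[T_{S,L}(A)]` for EVERY set `A` of labels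
  (`0 < a ≤ 1`, `0 ≤ b < 1`); proof: the push-forward of the product measure under the coordinatewise
  inverse map is again a product measure (Mathlib `Measure.infinitePi_map_pi`), whose restriction to
  the unit box over `S` is exactly `a^{#(S∩L)}(1-b)^{#(S∖L)} · labelMeasure` (checked on boxes,
  Mathlib `Measure.eq_infinitePi`);
* `NTW17.labelMeasure_le_of_affineRelabel` — **Lemma 4.2**: if `Φ(U) = T_{Ŝ(U), L̂(U)}(U)` maps
  `𝓐` into `𝓑` with `#Ŝ(U) ≤ s`, `L̂(U) ⊆ Ŝ(U)`, measurable pieces `𝓐 ∩ {Ŝ = S, L̂ = L}`, and the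
  changed set is recoverable from the image (`σ(Φ U) = Ŝ U` for some function `σ`), then
  `(a ∧ (1-b))^s · ℙ[𝓐] ≤ 2^s · ℙ[𝓑]`; `NTW17.labelMeasure_real_le_of_affineRelabel` is the printed
  form `ℙ[𝓐] ≤ (2/(a ∧ (1-b)))^s ℙ[𝓑]`.

## Design choices

No image of a set under a multivalued `Φ` is formed: the hypothesis "`S` is uniquely determined by
`ω'`" is the recovery function `σ`, the `2^s` is the number of subsets `L ⊆ S`, and the pieces
`𝓐 ∩ {Ŝ = S, L̂ = L}` are summed over the countably many pairs `(S, L)` (hence `[Countable V]`).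
Ties / injectivity of labels play no role. The vertex type `V` and the edge index `Sym2 V` are
arbitrary: nothing here is specific to slabs.

## Sources

* C. M. Newman, V. Tassion, W. Wu, *Critical percolation and the minimal spanning tree in slabs*,
  Comm. Pure Appl. Math. 70 (2017), arXiv:1512.09107: §4.1, Lemma 4.2 and its proof, and the Remark
  after it (pp. 19–20) [NewmanTassionWu2017].
* G. Grimmett, *Percolation*, 2nd ed. (1999), §1.3 p. 11 (the uniform coupling `labelMeasure`)
  [Grimmett1999].
-/

noncomputable section

namespace Literature.Probability.Percolation

open _root_.MeasureTheory Set
open scoped ENNReal Classical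

namespace NTW17

variable {V : Type*}

/-! ## The affine relabelling `T_{S,L}` -/

section Relabel

variable (a b : ℝ) (S L : Finset (Sym2 V))

/-- The one-coordinate map of the relabelling `T_{S,L}` at the edge `e`: `y ↦ a·y` if
`e ∈ S ∩ L` (lowered), `y ↦ b + (1-b)·y` if `e ∈ S ∖ L` (raised), `y ↦ y` if `e ∉ S`.
[cite: NewmanTassionWu2017, Lemma 4.2 (Remark, p. 20)] -/
def affineCoord (e : Sym2 V) (y : ℝ) : ℝ :=
  if e ∈ S then (if e ∈ L then a * y else b + (1 - b) * y) else y

/-- The one-coordinate inverse of `affineCoord`: `y ↦ y/a` on `S ∩ L`, `y ↦ (y-b)/(1-b)` on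
`S ∖ L`, identity off `S` (the description of `Φ⁻¹(ω')` in the statement of Lemma 4.2).
[cite: NewmanTassionWu2017, Lemma 4.2 (p. 19)] -/
def affineCoordInv (e : Sym2 V) (y : ℝ) : ℝ :=
  if e ∈ S then (if e ∈ L then y / a else (y - b) / (1 - b)) else y

/-- **The affine relabelling `T_{S,L}`** of a label configuration `U : Sym2 V → ℝ`: the labels of
the edges in `S ∩ L` are lowered (`U e ↦ a · U e`), those of the edges in `S ∖ L` are raised
(`U e ↦ b + (1 - b) · U e`), all other labels are unchanged.
[cite: NewmanTassionWu2017, Lemma 4.2 (Remark, p. 20)] -/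
def affineRelabel (U : Sym2 V → ℝ) : Sym2 V → ℝ :=
  fun e => affineCoord a b S L e (U e)

/-- The inverse relabelling `T_{S,L}⁻¹` (coordinatewise `affineCoordInv`).
[cite: NewmanTassionWu2017, Lemma 4.2 (p. 19)] -/
def affineRelabelInv (U : Sym2 V → ℝ) : Sym2 V → ℝ :=
  fun e => affineCoordInv a b S L e (U e)

variable {a b S L}

/-- Off `S` the relabelling changes nothing: `T_{S,L}(U)|_{Sᶜ} = U|_{Sᶜ}`.
[cite: NewmanTassionWu2017, Lemma 4.2 (p. 19)] -/
@[simp] theorem affineRelabel_apply_of_not_mem {e : Sym2 V} (he : e ∉ S) (U : Sym2 V → ℝ) :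
    affineRelabel a b S L U e = U e := by
  simp [affineRelabel, affineCoord, he]

/-- On `S ∩ L` the label is lowered: `T_{S,L}(U)(e) = a · U(e)`.
[cite: NewmanTassionWu2017, Lemma 4.2 (Remark, p. 20)] -/
@[simp] theorem affineRelabel_apply_of_mem_of_mem {e : Sym2 V} (heS : e ∈ S) (heL : e ∈ L)
    (U : Sym2 V → ℝ) : affineRelabel a b S L U e = a * U e := by
  simp [affineRelabel, affineCoord, heS, heL]

/-- On `S ∖ L` the label is raised: `T_{S,L}(U)(e) = b + (1 - b) · U(e)`.
[cite: NewmanTassionWu2017, Lemma 4.2 (Remark, p. 20)] -/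
@[simp] theorem affineRelabel_apply_of_mem_of_not_mem {e : Sym2 V} (heS : e ∈ S) (heL : e ∉ L)
    (U : Sym2 V → ℝ) : affineRelabel a b S L U e = b + (1 - b) * U e := by
  simp [affineRelabel, affineCoord, heS, heL]

/-- A lowered label is at most `a` (so the edge is open at level `a`) when the original label is
at most `1` and `0 ≤ a`. [cite: NewmanTassionWu2017, §4.1 Step 1 ("open all the edges", p. 20)] -/
theorem affineRelabel_apply_le_of_mem_of_mem {e : Sym2 V} (heS : e ∈ S) (heL : e ∈ L)
    (ha : 0 ≤ a) {U : Sym2 V → ℝ} (hU : U e ≤ 1) : affineRelabel a b S L U e ≤ a := by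
  rw [affineRelabel_apply_of_mem_of_mem heS heL]
  nlinarith

/-- A raised label is at least `b` (so the edge is closed at every level `< b`) when the original
label is nonnegative and `b ≤ 1`. [cite: NewmanTassionWu2017, §4.1 Step 3 ("close all the edges", p. 21)] -/
theorem le_affineRelabel_apply_of_mem_of_not_mem {e : Sym2 V} (heS : e ∈ S) (heL : e ∉ L)
    (hb : b ≤ 1) {U : Sym2 V → ℝ} (hU : 0 ≤ U e) : b ≤ affineRelabel a b S L U e := by
  rw [affineRelabel_apply_of_mem_of_not_mem heS heL]
  nlinarith

/-- The relabelling preserves `[0,1]`-valued labels when `0 ≤ a ≤ 1` and `0 ≤ b ≤ 1`.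
[cite: NewmanTassionWu2017, Lemma 4.2 (p. 19)] -/
theorem affineRelabel_apply_mem_Icc (ha0 : 0 ≤ a) (ha1 : a ≤ 1) (hb0 : 0 ≤ b) (hb1 : b ≤ 1)
    {U : Sym2 V → ℝ} {e : Sym2 V} (hU : U e ∈ Icc (0 : ℝ) 1) :
    affineRelabel a b S L U e ∈ Icc (0 : ℝ) 1 := by
  obtain ⟨h0, h1⟩ := hU
  by_cases heS : e ∈ S
  · by_cases heL : e ∈ L
    · rw [affineRelabel_apply_of_mem_of_mem heS heL]
      exact ⟨mul_nonneg ha0 h0, by nlinarith⟩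
    · rw [affineRelabel_apply_of_mem_of_not_mem heS heL]
      exact ⟨by nlinarith, by nlinarith⟩
  · rw [affineRelabel_apply_of_not_mem heS]
    exact ⟨h0, h1⟩

/-- At every level `p`, the configuration `η_p` of the relabelled labels agrees with that of the
original labels at every edge off `S` ("`ω|_{Sᶜ} = ω'|_{Sᶜ}`").
[cite: NewmanTassionWu2017, Lemma 4.2 (p. 19)] -/
theorem mem_configOfLabels_affineRelabel_iff_of_not_mem {e : Sym2 V} (he : e ∉ S) (p : ℝ)
    (U : Sym2 V → ℝ) (G : SimpleGraph V) :
    e ∈ configOfLabels p (affineRelabel a b S L U) G ↔ e ∈ configOfLabels p U G := by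
  simp [configOfLabels, affineRelabel_apply_of_not_mem he]

/-- A lowered edge of the graph is open at level `a` (original label `≤ 1`, `0 ≤ a`): Step 1 of
NTW's surgery "open all the edges in `Γ_z` (that is, take `ω(e) ↦ p_c ω(e)`)".
[cite: NewmanTassionWu2017, §4.1 Step 1 (p. 20)] -/
theorem mem_configOfLabels_affineRelabel_of_mem_of_mem {e : Sym2 V} (heS : e ∈ S) (heL : e ∈ L)
    {G : SimpleGraph V} (heG : e ∈ G.edgeSet) (ha : 0 ≤ a) {U : Sym2 V → ℝ} (hU : U e ≤ 1) :
    e ∈ configOfLabels a (affineRelabel a b S L U) G :=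
  ⟨heG, affineRelabel_apply_le_of_mem_of_mem heS heL ha hU⟩

/-- A raised edge is closed at every level `p < b` (original label `≥ 0`, `b ≤ 1`): Step 3 of
NTW's surgery "close all the edges … (that is, map `ω(e) ↦ b + (1-b)ω(e)` with `b > p_c`)".
[cite: NewmanTassionWu2017, §4.1 Step 3 (p. 21)] -/
theorem not_mem_configOfLabels_affineRelabel_of_mem_of_not_mem {e : Sym2 V} (heS : e ∈ S)
    (heL : e ∉ L) {p : ℝ} (hpb : p < b) (hb : b ≤ 1) {U : Sym2 V → ℝ} (hU : 0 ≤ U e)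
    (G : SimpleGraph V) : e ∉ configOfLabels p (affineRelabel a b S L U) G := by
  rintro ⟨-, hle⟩
  exact (lt_irrefl p) ((hpb.trans_le
    (le_affineRelabel_apply_of_mem_of_not_mem heS heL hb hU)).trans_le hle)

/-- Each coordinate map of `T_{S,L}` is measurable (NTW: "a measurable map `Φ : 𝓐 → 𝓑`").
[cite: NewmanTassionWu2017, Lemma 4.2 (p. 19, "a measurable map Φ")] -/
theorem measurable_affineCoord (e : Sym2 V) : Measurable (affineCoord a b S L e) := by
  unfold affineCoord
  by_cases heS : e ∈ S <;> by_cases heL : e ∈ L <;> simp only [heS, heL, if_true, if_false] <;>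
    fun_prop

/-- Each coordinate map of `T_{S,L}⁻¹` is measurable (NTW: "a measurable map `Φ : 𝓐 → 𝓑`").
[cite: NewmanTassionWu2017, Lemma 4.2 (p. 19, "a measurable map Φ")] -/
theorem measurable_affineCoordInv (e : Sym2 V) : Measurable (affineCoordInv a b S L e) := by
  unfold affineCoordInv
  by_cases heS : e ∈ S <;> by_cases heL : e ∈ L <;> simp only [heS, heL, if_true, if_false] <;>
    fun_prop

/-- `T_{S,L}` is measurable for the product σ-algebra (NTW: "a measurable map `Φ : 𝓐 → 𝓑`").
[cite: NewmanTassionWu2017, Lemma 4.2 (p. 19, "a measurable map Φ")] -/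
theorem measurable_affineRelabel : Measurable (affineRelabel a b S L : (Sym2 V → ℝ) → _) :=
  measurable_pi_lambda _ fun e => (measurable_affineCoord e).comp (measurable_pi_apply e)

/-- `T_{S,L}⁻¹` is measurable for the product σ-algebra (NTW: "a measurable map `Φ : 𝓐 → 𝓑`").
[cite: NewmanTassionWu2017, Lemma 4.2 (p. 19, "a measurable map Φ")] -/
theorem measurable_affineRelabelInv : Measurable (affineRelabelInv a b S L : (Sym2 V → ℝ) → _) :=
  measurable_pi_lambda _ fun e => (measurable_affineCoordInv e).comp (measurable_pi_apply e)

/-- **`T_{S,L}` as a measurable automorphism of the label space** (for `a ≠ 0`, `b ≠ 1`), with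
inverse `T_{S,L}⁻¹ = affineRelabelInv`. [cite: NewmanTassionWu2017, Lemma 4.2 (proof: "Φ|_{A_i} is a bijection", p. 20)] -/
def affineRelabelEquiv (ha : a ≠ 0) (hb : b ≠ 1) (S L : Finset (Sym2 V)) :
    (Sym2 V → ℝ) ≃ᵐ (Sym2 V → ℝ) where
  toFun := affineRelabel a b S L
  invFun := affineRelabelInv a b S L
  left_inv U := by
    have hb' : (1 - b) ≠ 0 := sub_ne_zero.2 (Ne.symm hb)
    funext e
    simp only [affineRelabel, affineRelabelInv, affineCoord, affineCoordInv]
    by_cases heS : e ∈ S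
    · by_cases heL : e ∈ L
      · simp only [heS, heL, if_true]
        field_simp
      · simp only [heS, heL, if_true, if_false]
        field_simp
        ring
    · simp only [heS, if_false]
  right_inv U := by
    have hb' : (1 - b) ≠ 0 := sub_ne_zero.2 (Ne.symm hb)
    funext e
    simp only [affineRelabel, affineRelabelInv, affineCoord, affineCoordInv]
    by_cases heS : e ∈ S
    · by_cases heL : e ∈ L
      · simp only [heS, heL, if_true]
        field_simp
      · simp only [heS, heL, if_true, if_false]
        field_simp
        ring
    · simp only [heS, if_false]
  measurable_toFun := measurable_affineRelabel
  measurable_invFun := measurable_affineRelabelInv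

/-- The underlying map of `affineRelabelEquiv` is `affineRelabel`.
[cite: NewmanTassionWu2017, Lemma 4.2 (proof, p. 20, "Φ|_{A_i} is a bijection")] -/
@[simp] theorem coe_affineRelabelEquiv (ha : a ≠ 0) (hb : b ≠ 1) (S L : Finset (Sym2 V)) :
    ⇑(affineRelabelEquiv ha hb S L) = affineRelabel a b S L := rfl

/-- The underlying map of the inverse of `affineRelabelEquiv` is `affineRelabelInv`.
[cite: NewmanTassionWu2017, Lemma 4.2 (proof, p. 20, "Φ|_{A_i} is a bijection")] -/
@[simp] theorem coe_affineRelabelEquiv_symm (ha : a ≠ 0) (hb : b ≠ 1) (S L : Finset (Sym2 V)) :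
    ⇑(affineRelabelEquiv ha hb S L).symm = affineRelabelInv a b S L := rfl

end Relabel

/-! ## The one-coordinate Jacobians -/

section OneCoordinate

/-- Lowering: the law of one uniform label pushed by `y ↦ y / a` (`0 < a ≤ 1`) gives mass
`a · Leb(t ∩ [0,1])` to `t ∩ [0,1]` — the one-dimensional Jacobian `a` of `ω ↦ aω`.
[cite: NewmanTassionWu2017, Lemma 4.2 (proof, "J_i(ω) ≥ a^{Card L_i}…", p. 20)] -/
theorem map_div_volume_restrict_inter_Icc {a : ℝ} (ha0 : 0 < a) (ha1 : a ≤ 1) {t : Set ℝ}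
    (ht : MeasurableSet t) :
    (((volume : Measure ℝ).restrict (Icc (0 : ℝ) 1)).map (fun y : ℝ => y / a)) (t ∩ Icc 0 1) =
      ENNReal.ofReal a * ((volume : Measure ℝ).restrict (Icc (0 : ℝ) 1)) t := by
  have hm : Measurable (fun y : ℝ => y / a) := by fun_prop
  rw [Measure.map_apply hm (ht.inter measurableSet_Icc),
    Measure.restrict_apply ((ht.inter measurableSet_Icc).preimage hm), Measure.restrict_apply ht]
  have hsub : (fun y : ℝ => y / a) ⁻¹' (t ∩ Icc 0 1) ⊆ Icc 0 1 := by
    intro y hy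
    simp only [mem_preimage, mem_inter_iff, mem_Icc] at hy
    obtain ⟨-, h0, h1⟩ := hy
    refine ⟨?_, ((div_le_one ha0).1 h1).trans ha1⟩
    have := mul_nonneg h0 ha0.le
    rwa [div_mul_cancel₀ y ha0.ne'] at this
  rw [inter_eq_left.2 hsub]
  have hfun : (fun y : ℝ => y / a) = (fun y => y * a⁻¹) := by
    funext y; exact div_eq_mul_inv y a
  rw [hfun, Real.volume_preimage_mul_right (inv_ne_zero ha0.ne'), inv_inv, abs_of_pos ha0]

/-- Raising: the law of one uniform label pushed by `y ↦ (y - b)/(1 - b)` (`0 ≤ b < 1`) gives mass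
`(1-b) · Leb(t ∩ [0,1])` to `t ∩ [0,1]` — the one-dimensional Jacobian `1 - b` of
`ω ↦ b + (1-b)ω`. [cite: NewmanTassionWu2017, Lemma 4.2 (proof, "…(1-b)^{Card(S∖L_i)}", p. 20)] -/
theorem map_subDiv_volume_restrict_inter_Icc {b : ℝ} (hb0 : 0 ≤ b) (hb1 : b < 1) {t : Set ℝ}
    (ht : MeasurableSet t) :
    (((volume : Measure ℝ).restrict (Icc (0 : ℝ) 1)).map (fun y : ℝ => (y - b) / (1 - b)))
        (t ∩ Icc 0 1) =
      ENNReal.ofReal (1 - b) * ((volume : Measure ℝ).restrict (Icc (0 : ℝ) 1)) t := by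
  have h1b : 0 < 1 - b := sub_pos.2 hb1
  have hm : Measurable (fun y : ℝ => (y - b) / (1 - b)) := by fun_prop
  rw [Measure.map_apply hm (ht.inter measurableSet_Icc),
    Measure.restrict_apply ((ht.inter measurableSet_Icc).preimage hm), Measure.restrict_apply ht]
  have hsub : (fun y : ℝ => (y - b) / (1 - b)) ⁻¹' (t ∩ Icc 0 1) ⊆ Icc 0 1 := by
    intro y hy
    simp only [mem_preimage, mem_inter_iff, mem_Icc] at hy
    obtain ⟨-, h0, h1⟩ := hy
    have h0' := mul_nonneg h0 h1b.le
    rw [div_mul_cancel₀ _ h1b.ne'] at h0'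
    have h1' := (div_le_one h1b).1 h1
    exact ⟨by linarith, by linarith⟩
  rw [inter_eq_left.2 hsub]
  have hpre : (fun y : ℝ => (y - b) / (1 - b)) ⁻¹' (t ∩ Icc 0 1) =
      (fun y : ℝ => y + (-b)) ⁻¹' ((fun z : ℝ => z * (1 - b)⁻¹) ⁻¹' (t ∩ Icc 0 1)) := by
    ext y
    simp [div_eq_mul_inv, sub_eq_add_neg]
  rw [hpre, measure_preimage_add_right, Real.volume_preimage_mul_right (inv_ne_zero h1b.ne'),
    inv_inv, abs_of_pos h1b]

end OneCoordinate

/-! ## The Jacobian inequality for `T_{S,L}` -/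

section Jacobian

variable {a b : ℝ}

/-- **The Jacobian inequality** (the change of variables in the proof of Lemma 4.2): for
`0 < a ≤ 1`, `0 ≤ b < 1` and EVERY set `A` of label configurations,
`a^{#(S ∩ L)} · (1-b)^{#(S ∖ L)} · ℙ[A] ≤ ℙ[T_{S,L}(A)]` — NTW: "`ℙ[𝓑] ≥ ∫_{Φ(A_i)} dω' =
∫_{A_i} J_i(ω) dω ≥ (a ∧ (1-b))^s ℙ[A_i]`". Proof: the push-forward of the product measure
`labelMeasure` under the coordinatewise map `T_{S,L}⁻¹` is the product of the pushed one-label laws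
(Mathlib `Measure.infinitePi_map_pi`); restricted to the unit box over `S` it agrees with
`a^{#(S∩L)}(1-b)^{#(S∖L)} · labelMeasure` on all boxes (`map_div_volume_restrict_inter_Icc`,
`map_subDiv_volume_restrict_inter_Icc`), hence everywhere (Mathlib `Measure.eq_infinitePi`).
[cite: NewmanTassionWu2017, Lemma 4.2 (proof, p. 20)] -/
theorem mul_labelMeasure_le_labelMeasure_image_affineRelabel (ha0 : 0 < a) (ha1 : a ≤ 1)
    (hb0 : 0 ≤ b) (hb1 : b < 1) (S L : Finset (Sym2 V)) (A : Set (Sym2 V → ℝ)) :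
    ENNReal.ofReal a ^ (S ∩ L).card * ENNReal.ofReal (1 - b) ^ (S \ L).card * labelMeasure V A ≤
      labelMeasure V (affineRelabel a b S L '' A) := by
  have hprob := isProbabilityMeasure_volume_restrict_unitInterval
  set μ₀ : Measure ℝ := (volume : Measure ℝ).restrict (Icc (0 : ℝ) 1) with hμ₀
  set E : (Sym2 V → ℝ) ≃ᵐ (Sym2 V → ℝ) := affineRelabelEquiv ha0.ne' hb1.ne S L with hE
  -- the Jacobian factors and the pushed one-label laws
  set c : Sym2 V → ℝ≥0∞ := fun e =>
    if e ∈ S then (if e ∈ L then ENNReal.ofReal a else ENNReal.ofReal (1 - b)) else 1 with hc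
  set ν : Sym2 V → Measure ℝ := fun e => μ₀.map (affineCoordInv a b S L e) with hν
  have hνprob : ∀ e, IsProbabilityMeasure (ν e) := fun e =>
    Measure.isProbabilityMeasure_map (measurable_affineCoordInv e).aemeasurable
  -- the push-forward of the label measure under `T⁻¹` is the product of the `ν e`
  have hmap : (labelMeasure V).map E.symm = Measure.infinitePi ν := by
    rw [coe_affineRelabelEquiv_symm]
    exact Measure.infinitePi_map_pi (fun _ : Sym2 V => μ₀) (fun e => measurable_affineCoordInv e)
  -- one coordinate at a time
  have hcoord : ∀ (e : Sym2 V) (t : Set ℝ), MeasurableSet t →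
      ν e (t ∩ (if e ∈ S then Icc (0 : ℝ) 1 else univ)) = c e * μ₀ t := by
    intro e t ht
    by_cases heS : e ∈ S
    · by_cases heL : e ∈ L
      · have hf : affineCoordInv a b S L e = fun y : ℝ => y / a := by
          funext y; simp [affineCoordInv, heS, heL]
        simp only [hν, hc, heS, heL, if_true, hf]
        exact map_div_volume_restrict_inter_Icc ha0 ha1 ht
      · have hf : affineCoordInv a b S L e = fun y : ℝ => (y - b) / (1 - b) := by
          funext y; simp [affineCoordInv, heS, heL]
        simp only [hν, hc, heS, heL, if_true, if_false, hf]
        exact map_subDiv_volume_restrict_inter_Icc hb0 hb1 ht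
    · have hf : affineCoordInv a b S L e = id := by
        funext y; simp [affineCoordInv, heS]
      simp only [hν, hc, heS, if_false, hf, Measure.map_id, inter_univ, one_mul]
  -- the unit box over `S` and the Jacobian `J`
  set Box : Set (Sym2 V → ℝ) := Set.pi (↑S) (fun _ => Icc (0 : ℝ) 1) with hBox
  have hBoxm : MeasurableSet Box := MeasurableSet.pi S.countable_toSet fun _ _ => measurableSet_Icc
  set J : ℝ≥0∞ := ∏ e ∈ S, c e with hJ
  have hc0 : ∀ e, c e ≠ 0 := by
    intro e
    simp only [hc]
    split_ifs
    · exact (ENNReal.ofReal_pos.2 ha0).ne'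
    · exact (ENNReal.ofReal_pos.2 (sub_pos.2 hb1)).ne'
    · exact one_ne_zero
  have hctop : ∀ e, c e ≠ ∞ := by
    intro e
    simp only [hc]
    split_ifs
    · exact ENNReal.ofReal_ne_top
    · exact ENNReal.ofReal_ne_top
    · exact ENNReal.one_ne_top
  have hJ0 : J ≠ 0 := Finset.prod_ne_zero_iff.2 fun e _ => hc0 e
  have hJtop : J ≠ ∞ := ENNReal.prod_ne_top fun e _ => hctop e
  -- the product measure of the `ν e` on (box over s') ∩ Box
  have hpi : ∀ (s' : Finset (Sym2 V)) (t : Sym2 V → Set ℝ), (∀ e, MeasurableSet (t e)) →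
      Measure.infinitePi ν (Set.pi ↑s' t ∩ Box) = J * ∏ e ∈ s', μ₀ (t e) := by
    intro s' t ht
    set t' : Sym2 V → Set ℝ := fun e => if e ∈ s' then t e else univ with ht'
    have ht'm : ∀ e, MeasurableSet (t' e) := by
      intro e; simp only [ht']; split_ifs; exacts [ht e, MeasurableSet.univ]
    set w : Sym2 V → Set ℝ := fun e => t' e ∩ (if e ∈ S then Icc (0 : ℝ) 1 else univ) with hw
    have hwm : ∀ e, MeasurableSet (w e) := by
      intro e; refine (ht'm e).inter ?_; split_ifs; exacts [measurableSet_Icc, MeasurableSet.univ]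
    have hset : Set.pi ↑s' t ∩ Box = Set.pi ↑(s' ∪ S) w := by
      ext U
      simp only [hBox, hw, ht', mem_inter_iff, mem_pi, Finset.mem_coe, Finset.mem_union]
      constructor
      · rintro ⟨h1, h2⟩ e he
        refine ⟨?_, ?_⟩
        · split_ifs with h
          · exact h1 e h
          · exact mem_univ _
        · split_ifs with h
          · exact h2 e h
          · exact mem_univ _
      · intro h
        refine ⟨fun e he => ?_, fun e he => ?_⟩
        · have := (h e (Or.inl he)).1
          rwa [if_pos he] at this
        · have := (h e (Or.inr he)).2
          rwa [if_pos he] at this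
    rw [hset, Measure.infinitePi_pi ν (fun e _ => hwm e)]
    calc ∏ e ∈ s' ∪ S, ν e (w e) = ∏ e ∈ s' ∪ S, c e * μ₀ (t' e) :=
          Finset.prod_congr rfl fun e _ => hcoord e (t' e) (ht'm e)
      _ = (∏ e ∈ s' ∪ S, c e) * ∏ e ∈ s' ∪ S, μ₀ (t' e) := Finset.prod_mul_distrib
      _ = J * ∏ e ∈ s', μ₀ (t e) := by
          congr 1
          · exact (Finset.prod_subset Finset.subset_union_right
              (fun e _ he => by simp [hc, he])).symm
          · rw [← Finset.prod_subset Finset.subset_union_left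
              (fun e _ he => by simp [ht', he])]
            exact Finset.prod_congr rfl fun e he => by simp [ht', he]
  -- hence `(infinitePi ν)|_Box = J • labelMeasure`
  have hρ : J⁻¹ • ((Measure.infinitePi ν).restrict Box) = labelMeasure V := by
    unfold labelMeasure
    apply Measure.eq_infinitePi
    intro s' t ht
    rw [Measure.smul_apply, Measure.restrict_apply (MeasurableSet.pi s'.countable_toSet
      fun e _ => ht e), hpi s' t ht, smul_eq_mul, ← mul_assoc, ENNReal.inv_mul_cancel hJ0 hJtop,
      one_mul]
  -- the Jacobian `J` in closed form
  have hJeq : J = ENNReal.ofReal a ^ (S ∩ L).card * ENNReal.ofReal (1 - b) ^ (S \ L).card := by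
    simp only [hJ, hc]
    rw [Finset.prod_congr rfl (fun e (he : e ∈ S) => if_pos he), Finset.prod_ite,
      Finset.prod_const, Finset.prod_const, Finset.filter_mem_eq_inter, ← Finset.sdiff_eq_filter]
  -- conclusion
  rw [← hJeq]
  calc J * labelMeasure V A = J * ((J⁻¹ • ((Measure.infinitePi ν).restrict Box)) A) := by
        rw [hρ]
    _ = (Measure.infinitePi ν).restrict Box A := by
        rw [Measure.smul_apply, smul_eq_mul, ← mul_assoc, ENNReal.mul_inv_cancel hJ0 hJtop,
          one_mul]
    _ = Measure.infinitePi ν (A ∩ Box) := Measure.restrict_apply' hBoxm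
    _ ≤ Measure.infinitePi ν A := measure_mono inter_subset_left
    _ = (labelMeasure V).map E.symm A := by rw [hmap]
    _ = labelMeasure V (E.symm ⁻¹' A) := E.symm.map_apply A
    _ = labelMeasure V (affineRelabel a b S L '' A) := by
        rw [← E.image_eq_preimage_symm, coe_affineRelabelEquiv]

/-- The Jacobian inequality with the uniform factor `(a ∧ (1-b))^{#S}`:
`(a ∧ (1-b))^{#S} · ℙ[A] ≤ ℙ[T_{S,L}(A)]` ("`J_i(ω) ≥ … ≥ (a ∧ (1-b))^s`").
[cite: NewmanTassionWu2017, Lemma 4.2 (proof, p. 20)] -/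
theorem min_pow_card_mul_labelMeasure_le (ha0 : 0 < a) (ha1 : a ≤ 1) (hb0 : 0 ≤ b)
    (hb1 : b < 1) (S L : Finset (Sym2 V)) (A : Set (Sym2 V → ℝ)) :
    ENNReal.ofReal (min a (1 - b)) ^ S.card * labelMeasure V A ≤
      labelMeasure V (affineRelabel a b S L '' A) := by
  refine le_trans ?_ (mul_labelMeasure_le_labelMeasure_image_affineRelabel ha0 ha1 hb0 hb1 S L A)
  gcongr
  have hcard : S.card = (S ∩ L).card + (S \ L).card := by
    rw [← Finset.filter_mem_eq_inter, Finset.sdiff_eq_filter]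
    exact (Finset.card_filter_add_card_filter_not _).symm
  rw [hcard, pow_add]
  gcongr
  · exact min_le_left _ _
  · exact min_le_right _ _

end Jacobian

/-! ## Lemma 4.2 -/

section Combinatorial

variable [Countable V] {a b : ℝ}

/-- **NTW Lemma 4.2 (the combinatorial lemma for continuous labels)**, multiplicative form. Let
`Φ(U) = T_{Ŝ(U), L̂(U)}(U)` relabel, for each `U ∈ 𝓐`, the at most `s` edges of `Ŝ(U)` (those of
`L̂(U) ⊆ Ŝ(U)` lowered by `ω ↦ aω`, the others raised by `ω ↦ b + (1-b)ω`), so that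
`Φ(𝓐) ⊆ 𝓑`, the pieces `𝓐 ∩ {Ŝ = S, L̂ = L}` are measurable, and "the set `S` of changed edges is
uniquely determined by `ω' = Φ(ω)`" (`σ (Φ U) = Ŝ U`). Then
`(a ∧ (1-b))^s · ℙ[𝓐] ≤ 2^s · ℙ[𝓑]`. Proof as printed: on each piece `Φ = T_{S,L}` has
Jacobian `≥ (a ∧ (1-b))^s` (`min_pow_card_mul_labelMeasure_le`); for fixed `S` the `≤ 2^{#S}`
pieces map into `Φ(𝓐 ∩ {Ŝ = S})`, and these images are pairwise disjoint in `S` (recovery) and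
contained in `𝓑`. [cite: NewmanTassionWu2017, Lemma 4.2 (pp. 19–20)] -/
theorem labelMeasure_le_of_affineRelabel (ha0 : 0 < a) (ha1 : a ≤ 1) (hb0 : 0 ≤ b)
    (hb1 : b < 1) (s : ℕ) {𝓐 𝓑 : Set (Sym2 V → ℝ)} (Sh Lh σ : (Sym2 V → ℝ) → Finset (Sym2 V))
    (hmeas : ∀ S L, MeasurableSet (𝓐 ∩ {U | Sh U = S ∧ Lh U = L}))
    (hcard : ∀ U ∈ 𝓐, (Sh U).card ≤ s) (hsub : ∀ U ∈ 𝓐, Lh U ⊆ Sh U)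
    (hmaps : ∀ U ∈ 𝓐, affineRelabel a b (Sh U) (Lh U) U ∈ 𝓑)
    (hrec : ∀ U ∈ 𝓐, σ (affineRelabel a b (Sh U) (Lh U) U) = Sh U) :
    ENNReal.ofReal (min a (1 - b)) ^ s * labelMeasure V 𝓐 ≤ 2 ^ s * labelMeasure V 𝓑 := by
  set μ := labelMeasure V with hμ
  set m : ℝ≥0∞ := ENNReal.ofReal (min a (1 - b)) with hm
  have hm1 : m ≤ 1 := ENNReal.ofReal_le_one.2 ((min_le_left _ _).trans ha1)
  set piece : Finset (Sym2 V) → Finset (Sym2 V) → Set (Sym2 V → ℝ) :=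
    fun S L => 𝓐 ∩ {U | Sh U = S ∧ Lh U = L} with hpiece
  set img : Finset (Sym2 V) → Set (Sym2 V → ℝ) :=
    fun S => ⋃ L ∈ S.powerset, affineRelabel a b S L '' piece S L with himg
  -- (1) `𝓐` is covered by its pieces
  have h1 : μ 𝓐 ≤ ∑' S, ∑ L ∈ S.powerset, μ (piece S L) := by
    have hcov : 𝓐 ⊆ ⋃ S, ⋃ L ∈ S.powerset, piece S L := by
      intro U hU
      exact mem_iUnion.2 ⟨Sh U, mem_iUnion₂.2 ⟨Lh U, Finset.mem_powerset.2 (hsub U hU),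
        hU, rfl, rfl⟩⟩
    calc μ 𝓐 ≤ μ (⋃ S, ⋃ L ∈ S.powerset, piece S L) := measure_mono hcov
      _ ≤ ∑' S, μ (⋃ L ∈ S.powerset, piece S L) := measure_iUnion_le _
      _ ≤ ∑' S, ∑ L ∈ S.powerset, μ (piece S L) :=
          ENNReal.tsum_le_tsum fun S => measure_biUnion_finset_le _ _
  -- (2) the Jacobian inequality on each piece
  have h2 : ∀ S L, m ^ s * μ (piece S L) ≤ μ (affineRelabel a b S L '' piece S L) := by
    intro S L
    rcases (piece S L).eq_empty_or_nonempty with h | ⟨U, hU⟩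
    · simp [h]
    · have hcardS : S.card ≤ s := hU.2.1 ▸ hcard U hU.1
      calc m ^ s * μ (piece S L) ≤ m ^ S.card * μ (piece S L) :=
            mul_le_mul' (pow_le_pow_right_of_le_one' hm1 hcardS) le_rfl
        _ ≤ μ (affineRelabel a b S L '' piece S L) :=
            min_pow_card_mul_labelMeasure_le ha0 ha1 hb0 hb1 S L (piece S L)
  -- (3) summing over the `≤ 2^s` lowered subsets `L ⊆ S`
  have h3 : ∀ S, m ^ s * ∑ L ∈ S.powerset, μ (piece S L) ≤ 2 ^ s * μ (img S) := by
    intro S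
    rw [Finset.mul_sum]
    calc ∑ L ∈ S.powerset, m ^ s * μ (piece S L) ≤ ∑ L ∈ S.powerset, μ (img S) := by
          refine Finset.sum_le_sum fun L hL => (h2 S L).trans (measure_mono ?_)
          exact subset_iUnion₂ (s := fun L (_ : L ∈ S.powerset) =>
            affineRelabel a b S L '' piece S L) L hL
      _ = 2 ^ S.card * μ (img S) := by
          rw [Finset.sum_const, Finset.card_powerset, nsmul_eq_mul]
          push_cast
          rfl
      _ ≤ 2 ^ s * μ (img S) := by
          rcases (img S).eq_empty_or_nonempty with h | ⟨ω, hω⟩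
          · simp [h]
          · obtain ⟨L, -, U, hU, -⟩ := mem_iUnion₂.1 hω
            have hcardS : S.card ≤ s := hU.2.1 ▸ hcard U hU.1
            gcongr
            exact one_le_two
  -- (4) the images: measurable, inside `𝓑`, pairwise disjoint (recovery)
  have h4meas : ∀ S, MeasurableSet (img S) := by
    intro S
    refine MeasurableSet.biUnion S.powerset.countable_toSet fun L _ => ?_
    rw [← coe_affineRelabelEquiv ha0.ne' hb1.ne]
    exact (MeasurableEquiv.measurableSet_image _).2 (hmeas S L)
  have h4sub : ∀ S, img S ⊆ 𝓑 := by
    intro S ω hω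
    obtain ⟨L, -, U, hU, rfl⟩ := mem_iUnion₂.1 hω
    have h := hmaps U hU.1
    rwa [hU.2.1, hU.2.2] at h
  have h4disj : Pairwise (Function.onFun Disjoint img) := by
    intro S S' hne
    rw [Function.onFun, Set.disjoint_left]
    rintro ω hω hω'
    obtain ⟨L, -, U, hU, rfl⟩ := mem_iUnion₂.1 hω
    obtain ⟨L', -, U', hU', hUU'⟩ := mem_iUnion₂.1 hω'
    have h₁ := hrec U hU.1
    rw [hU.2.1, hU.2.2] at h₁
    have h₂ := hrec U' hU'.1
    rw [hU'.2.1, hU'.2.2, hUU'] at h₂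
    exact hne (h₁.symm.trans h₂)
  have h4 : ∑' S, μ (img S) ≤ μ 𝓑 := by
    rw [← measure_iUnion h4disj h4meas]
    exact measure_mono (iUnion_subset h4sub)
  -- (5) assemble
  calc m ^ s * μ 𝓐 ≤ m ^ s * ∑' S, ∑ L ∈ S.powerset, μ (piece S L) := by gcongr
    _ = ∑' S, m ^ s * ∑ L ∈ S.powerset, μ (piece S L) := by rw [ENNReal.tsum_mul_left]
    _ ≤ ∑' S, 2 ^ s * μ (img S) := ENNReal.tsum_le_tsum h3
    _ = 2 ^ s * ∑' S, μ (img S) := ENNReal.tsum_mul_left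
    _ ≤ 2 ^ s * μ 𝓑 := by gcongr

/-- **NTW Lemma 4.2, printed form**: under the hypotheses of `labelMeasure_le_of_affineRelabel`,
`ℙ[𝓐] ≤ (2 / (a ∧ (1-b)))^s · ℙ[𝓑]`. [cite: NewmanTassionWu2017, Lemma 4.2 (p. 19)] -/
theorem labelMeasure_real_le_of_affineRelabel (ha0 : 0 < a) (ha1 : a ≤ 1) (hb0 : 0 ≤ b)
    (hb1 : b < 1) (s : ℕ) {𝓐 𝓑 : Set (Sym2 V → ℝ)} (Sh Lh σ : (Sym2 V → ℝ) → Finset (Sym2 V))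
    (hmeas : ∀ S L, MeasurableSet (𝓐 ∩ {U | Sh U = S ∧ Lh U = L}))
    (hcard : ∀ U ∈ 𝓐, (Sh U).card ≤ s) (hsub : ∀ U ∈ 𝓐, Lh U ⊆ Sh U)
    (hmaps : ∀ U ∈ 𝓐, affineRelabel a b (Sh U) (Lh U) U ∈ 𝓑)
    (hrec : ∀ U ∈ 𝓐, σ (affineRelabel a b (Sh U) (Lh U) U) = Sh U) :
    (labelMeasure V).real 𝓐 ≤ (2 / min a (1 - b)) ^ s * (labelMeasure V).real 𝓑 := by
  have hprob := isProbabilityMeasure_labelMeasure V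
  have hm0 : 0 < min a (1 - b) := lt_min ha0 (sub_pos.2 hb1)
  have h := labelMeasure_le_of_affineRelabel ha0 ha1 hb0 hb1 s Sh Lh σ hmeas hcard hsub hmaps hrec
  have h' := ENNReal.toReal_mono (ENNReal.mul_ne_top (by simp) (measure_ne_top _ _)) h
  rw [ENNReal.toReal_mul, ENNReal.toReal_mul, ENNReal.toReal_pow, ENNReal.toReal_pow,
    ENNReal.toReal_ofReal hm0.le, ENNReal.toReal_ofNat] at h'
  rw [measureReal_def, measureReal_def, div_pow, div_mul_eq_mul_div, le_div_iff₀ (pow_pos hm0 s),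
    mul_comm]
  exact h'

/-- **NTW Lemma 4.2, literal recovery** (`σ = Ŝ`: "`S(ω) = S(ω')`", as in the application of
§4.1 where the changed set is read off `ω'` by the same recipe as off `ω`): if moreover
`Ŝ (Φ U) = Ŝ U` on `𝓐`, then `ℙ[𝓐] ≤ (2 / (a ∧ (1-b)))^s · ℙ[𝓑]`.
[cite: NewmanTassionWu2017, Lemma 4.2 and §4.1 ("one can determine S(ω) = S(ω')", p. 21)] -/
theorem labelMeasure_real_le_of_affineRelabel_self (ha0 : 0 < a) (ha1 : a ≤ 1) (hb0 : 0 ≤ b)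
    (hb1 : b < 1) (s : ℕ) {𝓐 𝓑 : Set (Sym2 V → ℝ)} (Sh Lh : (Sym2 V → ℝ) → Finset (Sym2 V))
    (hmeas : ∀ S L, MeasurableSet (𝓐 ∩ {U | Sh U = S ∧ Lh U = L}))
    (hcard : ∀ U ∈ 𝓐, (Sh U).card ≤ s) (hsub : ∀ U ∈ 𝓐, Lh U ⊆ Sh U)
    (hmaps : ∀ U ∈ 𝓐, affineRelabel a b (Sh U) (Lh U) U ∈ 𝓑)
    (hrec : ∀ U ∈ 𝓐, Sh (affineRelabel a b (Sh U) (Lh U) U) = Sh U) :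
    (labelMeasure V).real 𝓐 ≤ (2 / min a (1 - b)) ^ s * (labelMeasure V).real 𝓑 :=
  labelMeasure_real_le_of_affineRelabel ha0 ha1 hb0 hb1 s Sh Lh Sh hmeas hcard hsub hmaps hrec

end Combinatorial

end NTW17

end Literature.Probability.Percolation
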